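import Literature.MathematicalPhysics.QuantumFieldTheory.Balaban1983to89.B9Eq333ProjectionCovariance

/-!
# `Balaban1983to89.B9Eq334LaplaceACovariance` — T. Bałaban, *Propagators for lattice gauge theories in a background field*, Commun. Math. Phys.
# **99** (1985) 389–434 [Balaban1985BackgroundPropagators] (3.34) p. 396: `Δ_a(U^u) = R(u)Δ_a(U)R(u⁻¹)`, `G(U^u) = R(u)G(U)R(u⁻¹)` FOR THE
# pub-balaban NE9 CHAIN'S ASSEMBLED OPERATOR `Δ_a(U) = Δ(U) + D R(U) D* + Q*(U) a Q(U)` (`B9Eq326OperatorAssembly.laplaceAofU`,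
# `B9Eq315QTorus.laplaceAofBackground`) AND ITS LETTERS `G₁(U) = Δ_a(U)⁻¹`, `(QG₁Q*)⁻¹`, `H₁(U)`, `𝔊(U)` — with the TRANSFER of the displayed
# positivity ([B9] Thm 3.11, `hpos`) along gauge orbits: `Δ_a(U)` is positive definite iff `Δ_a(U^u)` is

statement-level skeleton of published theorems with citation tags; proofs where landed; nothing here is a claim about the Yang–Mills mass gap

PDF held: `paper:balaban1985-cmp99-background-propagators` (journal page = PDF page + 388), p. 396 read by this seat (2026-08-22, text layer `p0008.txt`).

THE PRINT (verbatim, p. 396).  *«The equalities (3.31), (3.32) imply further G′(U^u) = R(u)G′(U)R(u⁻¹), R(U^u) = R(u)R(U)R(u⁻¹). (3.33) Finally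
inspecting the definitions of the averaging operators Q_j(U) for gauge fields we can see that the equalities (3.32) hold again. This implies the
transformation laws for the operators Δ_a and G: Δ_a(U^u) = R(u)Δ_a(U)R(u⁻¹), G(U^u) = R(u)G(U)R(u⁻¹). (3.34)»*; p. 395 (3.26):
*«Δ_a(U) = Δ(U) + D_U R(U) D*_U + Q*(U)aQ(U)»*; [B11] p. 294: *«We denote by G₁ an inverse operator to the operator Δ₁ + DRD* + aQ*Q.»*

WHY THIS FILE (cell context).  The pub-balaban NE9 owner's located successor note (t4-ne9-p1 g81): *«MISSING for the chain: covariance of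
`QtorusW` …, of `hessOp` …, of `RofU` …, then `laplaceAofBackground (U^g) ∘ Ad g = Ad g ∘ laplaceAofBackground U` ⇒ hpos transfer»*.  The first
three are `B9Eq333ProjectionCovariance.QtorusW_gaugeU`, `B9Eq330HessianCovariance.hessOp_gaugeU`, `B9Eq333ProjectionCovariance.RofU_gaugeU`; this
file assembles (3.34) from them and from the covariance of the derivative letters (`B9Eq328GaugeAction`), transfers the displayed positivity
`hpos` of every chart theorem of the row ((C2)(E)(F′)(H1)(H2)(S′)…, all stated for SMALL FIELDS `‖U(b) − 1‖ ≤ ε`) to the gauge orbit, and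
conjugates the letters `G₁`, `(QG₁Q*)⁻¹`, `H₁`, `𝔊` built on it — the algebraic half of print's passage from small fields to the regularity class
(3.35) *«there exists a gauge transformation u on □ such that U^u = e^{iηA}»*.

WHAT IS PROVED (sorry-free; 0 `def`; no inequality of the paper).  For EVERY background `U`, EVERY gauge function `g` with `R(u(x))` fibrewise
isometric (`hAd`), `τ` `Ad`-invariant (`hτ`) and `u(x)` unitary (`hstar`) — the three displayed readings of print's `U(N)`, `tr`:
* §1 [folklore] **`adjoint_intertwine`** (the Hilbert adjoint of an intertwined map is intertwined by unitary intertwiners), **`laplaceAofU_gaugeU`** —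
  (3.34a) for `B9Eq326OperatorAssembly.laplaceAofU` with ANY `Q`-slots `Q`, `Q′` intertwined by `R(u)` and a unitary `T_F` of their common target;
  **`laplaceAofBackground_gaugeU`** = (3.34a) `Δ_a(U^u)R(u) = R(u)Δ_a(U)` for the chain's fully assembled `B9Eq315QTorus.laplaceAofBackground`
  (`Q := Q(U)`, `T_F = R(u₁)` on the coarse bonds); `laplaceAofBackground_gaugeU_conj` (printed shape), `inner_laplaceAofBackground_gaugeU`.
* §2 **`hpos_gaugeU`**, **`hpos_of_hpos_gaugeU`**, **`hpos_gaugeU_iff`** — THE POSITIVITY TRANSFER: `(∀ x ≠ 0, 0 < re⟨x, Δ_a(U^u)x⟩) ↔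
  (∀ x ≠ 0, 0 < re⟨x, Δ_a(U)x⟩)`.
* §3 **`G1ofU_gaugeU`** = (3.34b) `G₁(U^u)R(u) = R(u)G₁(U)` (`B9Eq333Cov.inverse_intertwine` shape), **`KinvLatticeK_gaugeU`** (`(QG₁Q*)⁻¹`),
  **`H1ofU_gaugeU`** (`H₁(U^u)R(u₁) = R(u)H₁(U)`), **`frakGofU_gaugeU`** (`𝔊(U^u)R(u) = R(u)𝔊(U)`) — at any `Q`-slots intertwined as in §1, hence at
  `Q := Q(U)` (`G1ofBackground_gaugeU`).
MODEL / DECLARED READINGS.  (M1) the chain's encodings verbatim; (M2) DISPLAYED: `hAd`, `hτ`, `hstar` (as in the sibling files; `hAd` is a theorem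
under the (18)-compatibility, `B9Eq328GaugeAction.inner_AdW_AdW_of_compat`), positivity `hpos` on ONE side (the other is derived), `Q` onto on both
sides for `H₁`/`𝔊` (any witnesses); (M3) NOT HERE: the Dirichlet restriction `↾Ω₀` of (3.27) (the chain works on the full periodic lattice), the
norm equalities `‖G₁(U^u)‖ = ‖G₁(U)‖` in the Banach letters of [B11] (115), the chart theorems on the gauge orbit (successor item), any bound.
HONEST SCOPE.  [folklore] conjugation algebra on the cell's own typed objects realising the printed (3.34); the positivity of [B9] Thm 3.11 is
TRANSFERRED, never proved; no estimate of the paper; NOT summit progress (cell pub-balaban: NE9 NOT PRINTED / NOT PROVED; «NE9 ⇐ the named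
binders»; spine PROVED 0/9; HONEST DEPENDENCY: continuum YM on T⁴ ⇐ BetaPertH ∧ nine spine estimates (0/9 proved); BetaPertH ⇐ (D1) ∧ (D4) ∧
CAP+tail; G-an2-4 gates asym, D1 and NE2/3/4).  Unit `b2b-balaban-t4-ne9-formalise-leaf-03` (NE9 crux-team leaf prover, gen 60), INTENT
I-ne9leaf03-g60-1 file (G3); NEW file importing `B9Eq333ProjectionCovariance` only; modifies nothing.  Net new unproved facts: 0.
-/

noncomputable section

open scoped InnerProductSpace ComplexConjugate BigOperators

namespace Literature.MathematicalPhysics.QuantumFieldTheory.Balaban1983to89.B9Eq334LaplaceACovariance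

open B9SectCLatticeCarrier (Bond bpos btgt shift unshift)
open B4Sect5Torus (TSite)
open B9Eq311L2Pairing (WL2)
open B9Eq319QprimeTorus (fineP centre)
open B11Eq103H1Complex (SiteL2K BondL2K covDerivL2K covDivL2K laplaceAK laplaceALatticeK G1K G1LatticeK KinvLatticeK H1LatticeK frakGLatticeK
  laplaceALatticeK_G1LatticeK G1K_laplaceAK hK_lattice)
open B9Eq310HessianOperator (adTransportW hessOp)
open B9Eq326OperatorAssembly (RofU laplaceAofU laplaceAofU_eq G1ofU H1ofU frakGofU)
open B7Prop1Explicit (U1 Wcx boxVec)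
open B9Eq315QTorus (perCfg cornerSite QtorusW laplaceAofBackground laplaceAofBackground_eq)
open B9Eq328GaugeAction B9Eq330HessianCovariance B9Eq333ProjectionCovariance

variable {d : ℕ}

/-! ## §1 (3.34a): `Δ_a(U^u) R(u) = R(u) Δ_a(U)` -/

section Adjoint

variable {E F : Type*} [NormedAddCommGroup E] [InnerProductSpace ℂ E] [FiniteDimensional ℂ E] [NormedAddCommGroup F] [InnerProductSpace ℂ F]
  [FiniteDimensional ℂ F]

/-- [folklore] **The Hilbert adjoint of an intertwined map is intertwined**: if `Q′ T_E = T_F Q` with `T_E`, `T_F` isometric and `T_E` onto, then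
`Q′† T_F = T_E Q†` — print's *«Q′*(U^u)aQ′(U^u) = R(u)Q′*(U)aQ′(U)R(u⁻¹)»* mechanism (orthogonality of `R(u)`).
[cite: Balaban1985BackgroundPropagators, (3.32) p.395–396] -/
theorem adjoint_intertwine (Q Q' : E →ₗ[ℂ] F) (TE : E →ₗ[ℂ] E) (TF : F →ₗ[ℂ] F) (hTE : ∀ x y : E, ⟪TE x, TE y⟫_ℂ = ⟪x, y⟫_ℂ)
    (hTEs : Function.Surjective TE) (hTF : ∀ h h' : F, ⟪TF h, TF h'⟫_ℂ = ⟪h, h'⟫_ℂ) (hQ : ∀ f, Q' (TE f) = TF (Q f)) (h : F) :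
    LinearMap.adjoint Q' (TF h) = TE (LinearMap.adjoint Q h) := by
  apply ext_inner_right ℂ
  intro f'
  obtain ⟨f, rfl⟩ := hTEs f'
  rw [LinearMap.adjoint_inner_left, hQ, hTF, hTE, LinearMap.adjoint_inner_left]

end Adjoint

section LaplaceA

variable (L : ℕ) [NeZero L] (m : Fin d → ℕ) {𝔸 : Type*} [Ring 𝔸] [Algebra ℂ 𝔸] [StarRing 𝔸] [StarModule ℂ 𝔸]
  {W : Type*} [NormedAddCommGroup W] [InnerProductSpace ℂ W] [FiniteDimensional ℂ W] (φ : W ≃ₗ[ℂ] 𝔸) {c₀ : ℝ} [Fact (0 < c₀)]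
  (τ : 𝔸 →ₗ[ℂ] ℂ) (η : ℝ) {g : TSite d (fineP L m) → 𝔸ˣ} (U : Bond d (fineP L m) → 𝔸ˣ)
  {F : Type*} [NormedAddCommGroup F] [InnerProductSpace ℂ F] [FiniteDimensional ℂ F]
  (Q Q' : BondL2K ℂ d (fineP L m) c₀ W →ₗ[ℂ] F) (TF : F →ₗ[ℂ] F)
  (hτ : ∀ (x : TSite d (fineP L m)) (X : 𝔸), τ (AdA (g x) X) = τ X) (hstar : ∀ x, star (g x : 𝔸) = ((g x)⁻¹ : 𝔸ˣ))
  (hAd : ∀ (x : TSite d (fineP L m)) (v v' : W), ⟪AdW φ (g x) v, AdW φ (g x) v'⟫_ℂ = ⟪v, v'⟫_ℂ)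
  (hTF : ∀ h h' : F, ⟪TF h, TF h'⟫_ℂ = ⟪h, h'⟫_ℂ) (hQ : ∀ f, Q' (gaugeW φ (fun b : Bond d (fineP L m) => g (bpos b)) f) = TF (Q f))

omit [NeZero L] [StarRing 𝔸] [StarModule ℂ 𝔸] in
include hAd hTF hQ in
/-- The `Q*`-slot is intertwined: `Q′† T_F = R(u) Q†`. [cite: Balaban1985BackgroundPropagators, (3.32) p.396] -/
theorem adjointQ_gaugeU (h : F) :
    LinearMap.adjoint Q' (TF h) = gaugeW φ (fun b : Bond d (fineP L m) => g (bpos b)) (LinearMap.adjoint Q h) :=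
  adjoint_intertwine Q Q' _ TF (inner_gaugeW φ (w := fun _ : Bond d (fineP L m) => c₀) _ fun b => hAd (bpos b))
    (fun f => ⟨_, gaugeW_apply_inv φ _ f⟩) hTF hQ h

include hτ hstar hAd hTF hQ in
/-- **(3.34a) `Δ_a(U^u) R(u) = R(u) Δ_a(U)`** for the assembled operator `B9Eq326OperatorAssembly.laplaceAofU` (Hessian (3.10) + `D R(U) D*` + `Q* a Q`)
with ANY pair of `Q`-slots intertwined by `R(u)` and a unitary `T_F` — from (3.30) `hessOp_gaugeU`, (3.3)/(3.8) `covDerivL2K_gaugeU`/`covDivL2K_gaugeU`,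
(3.33b) `RofU_gaugeU` and the adjoint slot. [cite: Balaban1985BackgroundPropagators, (3.34) p.396, (3.26) p.395] -/
theorem laplaceAofU_gaugeU (a : ℝ) (f : BondL2K ℂ d (fineP L m) c₀ W) :
    laplaceAofU L m φ η (gaugeU g U) τ Q' a (gaugeW φ (fun b : Bond d (fineP L m) => g (bpos b)) f) =
      gaugeW φ (fun b : Bond d (fineP L m) => g (bpos b)) (laplaceAofU L m φ η U τ Q a f) := by
  have hQs : ∀ s : ℂ, LinearMap.adjoint Q' (s • Q' (gaugeW φ (fun b : Bond d (fineP L m) => g (bpos b)) f)) =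
      gaugeW φ (fun b : Bond d (fineP L m) => g (bpos b)) (LinearMap.adjoint Q (s • Q f)) := fun s => by
    rw [hQ, ← map_smul, adjointQ_gaugeU L m φ Q Q' TF hAd hTF hQ]
  rw [laplaceAofU_eq, laplaceAofU_eq, laplaceALatticeK, laplaceALatticeK, B11Eq103H1Complex.laplaceAK_apply, B11Eq103H1Complex.laplaceAK_apply,
    hessOp_gaugeU U φ τ η hτ hstar hAd, covDivL2K_gaugeU, RofU_gaugeU L m φ η U hAd, covDerivL2K_gaugeU, hQs, map_add, map_add]

end LaplaceA

section Background

variable (L : ℕ) [NeZero L] (m : Fin d → ℕ) [∀ i, NeZero (fineP L m i)] (hL : 1 ≤ L)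
  {𝔸 : Type*} [NormedRing 𝔸] [NormedAlgebra ℂ 𝔸] [CompleteSpace 𝔸] [NormOneClass 𝔸] [StarRing 𝔸] [StarModule ℂ 𝔸]
  {W : Type*} [NormedAddCommGroup W] [InnerProductSpace ℂ W] [FiniteDimensional ℂ W] (φ : W ≃ₗ[ℂ] 𝔸) {c₀ c₁ : ℝ} [Fact (0 < c₀)] [Fact (0 < c₁)]
  {g : TSite d (fineP L m) → 𝔸ˣ} (U : Bond d (fineP L m) → 𝔸ˣ) {α : ℝ} (hα1 : α ≤ 1 / 64)
  (hU1 : ∀ (x : B7Prop1Explicit.Site d) (κ : Fin d), perCfg (fineP L m) U x κ ∈ U1 𝔸)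
  (hreg : ∀ (y : TSite d m) (κ : Fin d) (r : Fin d → Fin L),
    ‖((Wcx L (perCfg (fineP L m) U) (cornerSite L y) κ (boxVec L r) : 𝔸ˣ) : 𝔸) - 1‖ ≤ α)
  (hU1' : ∀ (x : B7Prop1Explicit.Site d) (κ : Fin d), perCfg (fineP L m) (gaugeU g U) x κ ∈ U1 𝔸)
  (hreg' : ∀ (y : TSite d m) (κ : Fin d) (r : Fin d → Fin L),
    ‖((Wcx L (perCfg (fineP L m) (gaugeU g U)) (cornerSite L y) κ (boxVec L r) : 𝔸ˣ) : 𝔸) - 1‖ ≤ α)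
  (τ : 𝔸 →ₗ[ℂ] ℂ) (η : ℝ)
  (hτ : ∀ (x : TSite d (fineP L m)) (X : 𝔸), τ (AdA (g x) X) = τ X) (hstar : ∀ x, star (g x : 𝔸) = ((g x)⁻¹ : 𝔸ˣ))
  (hAd : ∀ (x : TSite d (fineP L m)) (v v' : W), ⟪AdW φ (g x) v, AdW φ (g x) v'⟫_ℂ = ⟪v, v'⟫_ℂ)

include hτ hstar hAd in
/-- **(3.34a) FOR THE FULLY ASSEMBLED `Δ_a(U)` OF THE CHAIN** (`B9Eq315QTorus.laplaceAofBackground`, `Q := Q(U)` on the torus):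
`Δ_a(U^u)(R(u)f) = R(u)(Δ_a(U)f)` — whatever regularity witnesses are supplied for `U` and `U^u`.
[cite: Balaban1985BackgroundPropagators, (3.34) p.396] -/
theorem laplaceAofBackground_gaugeU (a : ℝ) (f : BondL2K ℂ d (fineP L m) c₀ W) :
    laplaceAofBackground L m hL φ (gaugeU g U) hα1 hU1' hreg' τ η (c₁ := c₁) a (gaugeW φ (fun b : Bond d (fineP L m) => g (bpos b)) f) =
      gaugeW φ (fun b : Bond d (fineP L m) => g (bpos b)) (laplaceAofBackground L m hL φ U hα1 hU1 hreg τ η (c₁ := c₁) a f) := by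
  rw [laplaceAofBackground_eq, laplaceAofBackground_eq]
  exact laplaceAofU_gaugeU L m φ τ η U (QtorusW L m hL φ U hα1 hU1 hreg (c₁ := c₁)) (QtorusW L m hL φ (gaugeU g U) hα1 hU1' hreg' (c₁ := c₁))
    (gaugeW φ fun c : Bond d m => g (centre L m (bpos c))) hτ hstar hAd
    (inner_gaugeW φ (w := fun _ : Bond d m => c₁) _ fun c => hAd (centre L m (bpos c)))
    (fun f => QtorusW_gaugeU L m g U hL φ hα1 hU1 hreg hU1' hreg' f) a f

include hτ hstar hAd hU1 hreg in
/-- **(3.34a) in the printed shape `Δ_a(U^u) = R(u)Δ_a(U)R(u⁻¹)`** as an equality of linear maps. [cite: Balaban1985BackgroundPropagators, (3.34) p.396] -/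
theorem laplaceAofBackground_gaugeU_conj (a : ℝ) :
    laplaceAofBackground L m hL φ (gaugeU g U) hα1 hU1' hreg' τ η (c₀ := c₀) (c₁ := c₁) a =
      gaugeW φ (fun b : Bond d (fineP L m) => g (bpos b)) ∘ₗ laplaceAofBackground L m hL φ U hα1 hU1 hreg τ η (c₁ := c₁) a ∘ₗ
        gaugeW φ (fun b : Bond d (fineP L m) => g (bpos b))⁻¹ := by
  apply LinearMap.ext
  intro f
  rw [LinearMap.comp_apply, LinearMap.comp_apply, ← laplaceAofBackground_gaugeU L m hL φ U hα1 hU1 hreg hU1' hreg' τ η hτ hstar hAd,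
    gaugeW_apply_inv]

include hτ hstar hAd in
/-- The quadratic form of `Δ_a` is gauge invariant: `⟨R(u)f, Δ_a(U^u)R(u)f⟩ = ⟨f, Δ_a(U)f⟩`. [cite: Balaban1985BackgroundPropagators, (3.34) p.396] -/
theorem inner_laplaceAofBackground_gaugeU (a : ℝ) (f : BondL2K ℂ d (fineP L m) c₀ W) :
    ⟪gaugeW φ (fun b : Bond d (fineP L m) => g (bpos b)) f, laplaceAofBackground L m hL φ (gaugeU g U) hα1 hU1' hreg' τ η (c₁ := c₁) a
        (gaugeW φ (fun b : Bond d (fineP L m) => g (bpos b)) f)⟫_ℂ =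
      ⟪f, laplaceAofBackground L m hL φ U hα1 hU1 hreg τ η (c₁ := c₁) a f⟫_ℂ := by
  rw [laplaceAofBackground_gaugeU L m hL φ U hα1 hU1 hreg hU1' hreg' τ η hτ hstar hAd,
    inner_gaugeW φ (w := fun _ : Bond d (fineP L m) => c₀) _ fun b => hAd (bpos b)]

/-! ## §2 The displayed positivity ([B9] Thm 3.11) transfers along the gauge orbit -/

include hτ hstar hAd hU1 hreg in
/-- **`Δ_a(U)` positive definite ⇒ `Δ_a(U^u)` positive definite.** [cite: Balaban1985BackgroundPropagators, Thm 3.11 p.416, (3.34) p.396] -/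
theorem hpos_gaugeU (a : ℝ)
    (hpos : ∀ x : BondL2K ℂ d (fineP L m) c₀ W, x ≠ 0 → 0 < RCLike.re ⟪x, laplaceAofBackground L m hL φ U hα1 hU1 hreg τ η (c₁ := c₁) a x⟫_ℂ)
    (x : BondL2K ℂ d (fineP L m) c₀ W) (hx : x ≠ 0) :
    0 < RCLike.re ⟪x, laplaceAofBackground L m hL φ (gaugeU g U) hα1 hU1' hreg' τ η (c₁ := c₁) a x⟫_ℂ := by
  obtain ⟨y, rfl⟩ : ∃ y, gaugeW φ (fun b : Bond d (fineP L m) => g (bpos b)) y = x := ⟨_, gaugeW_apply_inv φ _ x⟩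
  have hy : y ≠ 0 := fun h => hx (by rw [h, map_zero])
  rw [inner_laplaceAofBackground_gaugeU L m hL φ U hα1 hU1 hreg hU1' hreg' τ η hτ hstar hAd]
  exact hpos y hy

include hτ hstar hAd hU1' hreg' in
/-- **`Δ_a(U^u)` positive definite ⇒ `Δ_a(U)` positive definite** (same identity read backwards — no inverse gauge needed).
[cite: Balaban1985BackgroundPropagators, Thm 3.11 p.416, (3.34) p.396] -/
theorem hpos_of_hpos_gaugeU (a : ℝ)
    (hpos' : ∀ x : BondL2K ℂ d (fineP L m) c₀ W, x ≠ 0 →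
      0 < RCLike.re ⟪x, laplaceAofBackground L m hL φ (gaugeU g U) hα1 hU1' hreg' τ η (c₁ := c₁) a x⟫_ℂ)
    (y : BondL2K ℂ d (fineP L m) c₀ W) (hy : y ≠ 0) :
    0 < RCLike.re ⟪y, laplaceAofBackground L m hL φ U hα1 hU1 hreg τ η (c₁ := c₁) a y⟫_ℂ := by
  have hx : gaugeW φ (fun b : Bond d (fineP L m) => g (bpos b)) y ≠ 0 := fun h => hy ((gaugeW_eq_zero_iff φ _ y).1 h)
  rw [← inner_laplaceAofBackground_gaugeU L m hL φ U hα1 hU1 hreg hU1' hreg' τ η hτ hstar hAd]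
  exact hpos' _ hx

include hτ hstar hAd in
/-- **THE POSITIVITY TRANSFER**: `Δ_a(U^u)` is positive definite iff `Δ_a(U)` is — [B9] Thm 3.11's hypothesis slot of every chart theorem of the
chain is GAUGE INVARIANT. [cite: Balaban1985BackgroundPropagators, Thm 3.11 p.416, (3.34) p.396] -/
theorem hpos_gaugeU_iff (a : ℝ) :
    (∀ x : BondL2K ℂ d (fineP L m) c₀ W, x ≠ 0 →
        0 < RCLike.re ⟪x, laplaceAofBackground L m hL φ (gaugeU g U) hα1 hU1' hreg' τ η (c₁ := c₁) a x⟫_ℂ) ↔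
      ∀ x : BondL2K ℂ d (fineP L m) c₀ W, x ≠ 0 → 0 < RCLike.re ⟪x, laplaceAofBackground L m hL φ U hα1 hU1 hreg τ η (c₁ := c₁) a x⟫_ℂ :=
  ⟨fun h => hpos_of_hpos_gaugeU L m hL φ U hα1 hU1 hreg hU1' hreg' τ η hτ hstar hAd a h,
    fun h => hpos_gaugeU L m hL φ U hα1 hU1 hreg hU1' hreg' τ η hτ hstar hAd a h⟩

end Background

/-! ## §3 (3.34b): `G₁(U^u) R(u) = R(u) G₁(U)`, and the letters `(QG₁Q*)⁻¹`, `H₁`, `𝔊` -/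

section Letters

variable (L : ℕ) [NeZero L] (m : Fin d → ℕ) {𝔸 : Type*} [Ring 𝔸] [Algebra ℂ 𝔸] [StarRing 𝔸] [StarModule ℂ 𝔸]
  {W : Type*} [NormedAddCommGroup W] [InnerProductSpace ℂ W] [FiniteDimensional ℂ W] (φ : W ≃ₗ[ℂ] 𝔸) {c₀ : ℝ} [Fact (0 < c₀)]
  (τ : 𝔸 →ₗ[ℂ] ℂ) (η : ℝ) {g : TSite d (fineP L m) → 𝔸ˣ} (U : Bond d (fineP L m) → 𝔸ˣ)
  {F : Type*} [NormedAddCommGroup F] [InnerProductSpace ℂ F] [FiniteDimensional ℂ F]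
  {Q Q' : BondL2K ℂ d (fineP L m) c₀ W →ₗ[ℂ] F} (TF : F →ₗ[ℂ] F) {a : ℝ}
  (hτ : ∀ (x : TSite d (fineP L m)) (X : 𝔸), τ (AdA (g x) X) = τ X) (hstar : ∀ x, star (g x : 𝔸) = ((g x)⁻¹ : 𝔸ˣ))
  (hAd : ∀ (x : TSite d (fineP L m)) (v v' : W), ⟪AdW φ (g x) v, AdW φ (g x) v'⟫_ℂ = ⟪v, v'⟫_ℂ)
  (hTF : ∀ h h' : F, ⟪TF h, TF h'⟫_ℂ = ⟪h, h'⟫_ℂ) (hQ : ∀ f, Q' (gaugeW φ (fun b : Bond d (fineP L m) => g (bpos b)) f) = TF (Q f))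
  (hpos : ∀ x : BondL2K ℂ d (fineP L m) c₀ W, x ≠ 0 → 0 < RCLike.re ⟪x, laplaceAofU L m φ η U τ Q a x⟫_ℂ)
  (hpos' : ∀ x : BondL2K ℂ d (fineP L m) c₀ W, x ≠ 0 → 0 < RCLike.re ⟪x, laplaceAofU L m φ η (gaugeU g U) τ Q' a x⟫_ℂ)

include hτ hstar hAd hTF hQ in
/-- **(3.34b) `G₁(U^u) R(u) = R(u) G₁(U)`** for `G₁ = Δ_a⁻¹` (`B9Eq326OperatorAssembly.G1ofU`; positivity displayed on both sides — one follows from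
the other by §2): an inverse is intertwined when the operator is (`B9Eq333Cov.inverse_intertwine`). [cite: Balaban1985BackgroundPropagators, (3.34) p.396] -/
theorem G1ofU_gaugeU (f : BondL2K ℂ d (fineP L m) c₀ W) :
    G1ofU L m φ η (gaugeU g U) τ hpos' (gaugeW φ (fun b : Bond d (fineP L m) => g (bpos b)) f) =
      gaugeW φ (fun b : Bond d (fineP L m) => g (bpos b)) (G1ofU L m φ η U τ hpos f) := by
  have key : laplaceAofU L m φ η (gaugeU g U) τ Q' a (gaugeW φ (fun b : Bond d (fineP L m) => g (bpos b)) (G1ofU L m φ η U τ hpos f)) =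
      gaugeW φ (fun b : Bond d (fineP L m) => g (bpos b)) f := by
    rw [laplaceAofU_gaugeU L m φ τ η U Q Q' TF hτ hstar hAd hTF hQ,
      show laplaceAofU L m φ η U τ Q a (G1ofU L m φ η U τ hpos f) = f from laplaceALatticeK_G1LatticeK hpos f]
  rw [← key]
  exact G1K_laplaceAK hpos' _

variable (hQs : Function.Surjective Q) (hQs' : Function.Surjective Q')

include hτ hstar hAd hTF hQ in
/-- **`(Q′G₁′Q′*)⁻¹ T_F = T_F (QG₁Q*)⁻¹`** for the constructed `B11Eq103H1Complex.KinvLatticeK` (`Q` onto displayed on both sides).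
[cite: Balaban1985BackgroundPropagators, (3.34) p.396; Balaban1985Variational, (45) p.285] -/
theorem KinvLatticeK_gaugeU (h : F) : KinvLatticeK hpos' hQs' (TF h) = TF (KinvLatticeK hpos hQs h) := by
  have hK : Q' (G1ofU L m φ η (gaugeU g U) τ hpos' (LinearMap.adjoint Q' (TF (KinvLatticeK hpos hQs h)))) = TF h := by
    rw [adjointQ_gaugeU L m φ Q Q' TF hAd hTF hQ, G1ofU_gaugeU L m φ τ η U TF hτ hstar hAd hTF hQ hpos hpos', hQ,
      show Q (G1ofU L m φ η U τ hpos (LinearMap.adjoint Q (KinvLatticeK hpos hQs h))) = h from hK_lattice hpos hQs h]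
  rw [← hK]
  exact B11Eq103H1Complex.greenK_apply (B11Eq103H1Complex.re_inner_KK_pos hpos' B11Eq103H1Complex.hadj_adjoint
    (B11Eq103H1Complex.adjoint_injective_of_surjective Q' hQs')) _

include hτ hstar hAd hTF hQ in
/-- **`H₁(U^u) T_F = R(u) H₁(U)`** for `H₁ = G₁Q*(QG₁Q*)⁻¹` (`B9Eq326OperatorAssembly.H1ofU`). [cite: Balaban1985BackgroundPropagators, (3.34) p.396, (3.126) p.420] -/
theorem H1ofU_gaugeU (b : F) :
    H1ofU L m φ η (gaugeU g U) τ hpos' hQs' (TF b) = gaugeW φ (fun b : Bond d (fineP L m) => g (bpos b)) (H1ofU L m φ η U τ hpos hQs b) := by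
  show G1ofU L m φ η (gaugeU g U) τ hpos' (LinearMap.adjoint Q' (KinvLatticeK hpos' hQs' (TF b))) =
    gaugeW φ (fun b : Bond d (fineP L m) => g (bpos b)) (G1ofU L m φ η U τ hpos (LinearMap.adjoint Q (KinvLatticeK hpos hQs b)))
  rw [KinvLatticeK_gaugeU L m φ τ η U TF hτ hstar hAd hTF hQ hpos hpos' hQs hQs', adjointQ_gaugeU L m φ Q Q' TF hAd hTF hQ,
    G1ofU_gaugeU L m φ τ η U TF hτ hstar hAd hTF hQ hpos hpos']

include hτ hstar hAd hTF hQ in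
/-- **`𝔊(U^u) R(u) = R(u) 𝔊(U)`** for `𝔊 = G₁ − G₁Q*(QG₁Q*)⁻¹QG₁ − G₁DRD*G₁` (`B9Eq326OperatorAssembly.frakGofU`, [B9] (3.153)).
[cite: Balaban1985BackgroundPropagators, (3.34) p.396, (3.153) p.426] -/
theorem frakGofU_gaugeU (f : BondL2K ℂ d (fineP L m) c₀ W) :
    frakGofU L m φ η (gaugeU g U) τ hpos' hQs' (gaugeW φ (fun b : Bond d (fineP L m) => g (bpos b)) f) =
      gaugeW φ (fun b : Bond d (fineP L m) => g (bpos b)) (frakGofU L m φ η U τ hpos hQs f) := by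
  show frakGLatticeK hpos' hQs' _ = gaugeW φ (fun b : Bond d (fineP L m) => g (bpos b)) (frakGLatticeK hpos hQs f)
  rw [frakGLatticeK, frakGLatticeK, B11Eq111FrakG.frakGLin_apply, B11Eq111FrakG.frakGLin_apply]
  have hG := G1ofU_gaugeU L m φ τ η U TF hτ hstar hAd hTF hQ hpos hpos'
  simp only [G1ofU] at hG
  rw [hG, hQ, KinvLatticeK_gaugeU L m φ τ η U TF hτ hstar hAd hTF hQ hpos hpos' hQs hQs', adjointQ_gaugeU L m φ Q Q' TF hAd hTF hQ, hG,
    covDivL2K_gaugeU, RofU_gaugeU L m φ η U hAd, covDerivL2K_gaugeU, hG, map_sub, map_sub]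

end Letters

/-! ## §4 (v1.1, APPEND-ONLY): (3.34b) at the chain's torus `Q`-slots — the name the v1 header announced (reader ne9-leaf-02 g59, ASK A-2 / J15) -/

section BackgroundLetters

variable (L : ℕ) [NeZero L] (m : Fin d → ℕ) [∀ i, NeZero (fineP L m i)] (hL : 1 ≤ L)
  {𝔸 : Type*} [NormedRing 𝔸] [NormedAlgebra ℂ 𝔸] [CompleteSpace 𝔸] [NormOneClass 𝔸] [StarRing 𝔸] [StarModule ℂ 𝔸]
  {W : Type*} [NormedAddCommGroup W] [InnerProductSpace ℂ W] [FiniteDimensional ℂ W] (φ : W ≃ₗ[ℂ] 𝔸) {c₀ c₁ : ℝ} [Fact (0 < c₀)] [Fact (0 < c₁)]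
  {g : TSite d (fineP L m) → 𝔸ˣ} (U : Bond d (fineP L m) → 𝔸ˣ) {α : ℝ} (hα1 : α ≤ 1 / 64)
  (hU1 : ∀ (x : B7Prop1Explicit.Site d) (κ : Fin d), perCfg (fineP L m) U x κ ∈ U1 𝔸)
  (hreg : ∀ (y : TSite d m) (κ : Fin d) (r : Fin d → Fin L),
    ‖((Wcx L (perCfg (fineP L m) U) (cornerSite L y) κ (boxVec L r) : 𝔸ˣ) : 𝔸) - 1‖ ≤ α)
  (hU1' : ∀ (x : B7Prop1Explicit.Site d) (κ : Fin d), perCfg (fineP L m) (gaugeU g U) x κ ∈ U1 𝔸)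
  (hreg' : ∀ (y : TSite d m) (κ : Fin d) (r : Fin d → Fin L),
    ‖((Wcx L (perCfg (fineP L m) (gaugeU g U)) (cornerSite L y) κ (boxVec L r) : 𝔸ˣ) : 𝔸) - 1‖ ≤ α)
  (τ : 𝔸 →ₗ[ℂ] ℂ) (η : ℝ)
  (hτ : ∀ (x : TSite d (fineP L m)) (X : 𝔸), τ (AdA (g x) X) = τ X) (hstar : ∀ x, star (g x : 𝔸) = ((g x)⁻¹ : 𝔸ˣ))
  (hAd : ∀ (x : TSite d (fineP L m)) (v v' : W), ⟪AdW φ (g x) v, AdW φ (g x) v'⟫_ℂ = ⟪v, v'⟫_ℂ)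

include hτ hstar hAd in
set_option maxHeartbeats 1600000 in
-- the positivity witnesses are re-read through `laplaceAofBackground` = `laplaceAofU …` = `laplaceALatticeK …` (slow `whnf`; reader ne9-leaf-02 g59's J15)
/-- **(3.34b) `G₁(U^u) R(u) = R(u) G₁(U)` AT THE CHAIN'S TORUS `Q`-SLOTS** (`Q := Q(U)`, `Q′ := Q(U^u)`, `T_F := R(u₁)` at the block centres) for
`B9Eq315QTorusOnto.G1ofBackground` — §3's `G1ofU_gaugeU` instantiated exactly as §1's `laplaceAofBackground_gaugeU` instantiates `laplaceAofU_gaugeU`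
(positivity displayed on both sides; one follows from the other by `hpos_gaugeU`). [cite: Balaban1985BackgroundPropagators, (3.34) p.396] -/
theorem G1ofBackground_gaugeU {a : ℝ}
    (hpos : ∀ x : BondL2K ℂ d (fineP L m) c₀ W, x ≠ 0 → 0 < RCLike.re ⟪x, laplaceAofBackground L m hL φ U hα1 hU1 hreg τ η (c₁ := c₁) a x⟫_ℂ)
    (hpos' : ∀ x : BondL2K ℂ d (fineP L m) c₀ W, x ≠ 0 →
      0 < RCLike.re ⟪x, laplaceAofBackground L m hL φ (gaugeU g U) hα1 hU1' hreg' τ η (c₁ := c₁) a x⟫_ℂ)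
    (f : BondL2K ℂ d (fineP L m) c₀ W) :
    B9Eq315QTorusOnto.G1ofBackground L m hL φ (gaugeU g U) hα1 hU1' hreg' τ η hpos' (gaugeW φ (fun b : Bond d (fineP L m) => g (bpos b)) f) =
      gaugeW φ (fun b : Bond d (fineP L m) => g (bpos b)) (B9Eq315QTorusOnto.G1ofBackground L m hL φ U hα1 hU1 hreg τ η hpos f) :=
  G1ofU_gaugeU L m φ τ η U (gaugeW φ fun c : Bond d m => g (centre L m (bpos c))) hτ hstar hAd
    (inner_gaugeW φ (w := fun _ : Bond d m => c₁) _ fun c => hAd (centre L m (bpos c)))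
    (fun f => QtorusW_gaugeU L m g U hL φ hα1 hU1 hreg hU1' hreg' f) hpos hpos' f

end BackgroundLetters

end Literature.MathematicalPhysics.QuantumFieldTheory.Balaban1983to89.B9Eq334LaplaceACovariance

end
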